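import Summits.NavierStokesRegularity.NavierStokesRegularity.Theorems.AxisTwistDoorAveragedConeLiouvilleShellCover
import Summits.NavierStokesRegularity.NavierStokesRegularity.Theorems.AxisTwistDoorAveragedConeLiouvilleShellRadialGap
import Summits.NavierStokesRegularity.NavierStokesRegularity.Theorems.AxisTwistDoorAveragedConeLiouvilleShellBookkeeping
import Summits.NavierStokesRegularity.NavierStokesRegularity.Theorems.AxisTwistDoorAveragedConeLiouvilleCircleLimits
import Literature.Analysis.FluidPDE.SlabTypeICompactnessSharp
import Literature.Analysis.FluidPDE.PartialRegularityHolds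
import HarnessLib

/-!
# Route `AxisTwistDoor`, crux `AveragedConeLiouville` (stmt-NavierStokesRegularity-26889) — INPUT N3 (`ShellFact` by the
# compactness–contradiction route), piece S5 part 2: `ShellFact` FROM THE FOUR ATOM TEXTS

N3 cut of record (pub/ns-inputs STATUS 2026-08-28T12:41:44Z, texts OK 12:52:02Z; `kits/N3-skeleton.lean` 815f0a7c119d2985): the skeleton's
`stub_shellFact_of_atoms : Sig.lidNull → Sig.gradBound → Sig.radialGap → Sig.stability → ShellFact` with the four `Sig` texts δ-UNFOLDED (a
Theorems file cannot import the kit; glue `example` checked against the texts pasted verbatim), so the closer is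
`theorem shellFact_holds : ShellFact := shellFact_of_atoms lidNull gradBound radialGap stability` once S4 lands.

THE PROOF (Lei–Ren's quantitative shell, qualitatively, by compactness).  Fix `I₀ < ∞` and suppose no `(δ₀, B)` works: for every `n`
a class member `(Cₙ, vₙ, πₙ, Hₙ)` with `𝐈 ≤ I₀` violates the bound `n` on EVERY shell of width `≥ 1/(n+1)`.  Normalise the pressures to
unit-ball mean zero ([U] by name: `sub_unitBallMean_slab`, `typeIBound_sub_unitBallMean`).  COMPACTNESS (`slab_typeI_compactness_sharp`):
along `σ`, `v_{σk} → u` in `L³(Q(0,R))` for every `R`, the limit `(u,p,H)` slab-suitable with `𝐈 ≤ I₀`.  SINGULAR SET: the slab-singular set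
`Σ♭ = K₀ ∖ G(u)` (`K₀ = [−1,0] × {½ ≤ cylRadius ≤ 1, |x₃| ≤ 1}`, `G(u)` the open slab-regular set of part 1) is COMPACT and
`𝒫¹`-null: `Σ♭ ⊆ singularSet u ({t<0}) ∪ lid-singular` (part 1), null by `ckn_partial_regularity_holds` (interior) and S1 (lid).  RADIAL GAP
(S3): a band `a ± 2δ'` in `]2/3, 4/5[` missed by `Σ♭`; `δ = min(δ', 1/10)`.  COVER: the closed shell `S̄ = [−(a+δ)², 0] × {a−δ ≤ cylRadius ≤
a+δ, |x₃| ≤ a+δ}` is compact and inside `G(u)`; at each `w ∈ S̄` the raised-vertex cylinder `Q(z̄_w, ρ_w/2)` carries `u`'s essential bound, so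
S4 bounds `v_{σk}`, `k ≥ k_w`, by `B_w` on `Q(z̄_w, ρ_w/4) ⊇ O_w ∩ {t<0}` with the open box `O_w ∋ w`; a finite subcover `T` gives `B_* = Σ|B_w|`,
`k_* = Σ k_w` and a Lebesgue number `λ`.  POINTWISE (S2): for a shell point `ζ = (t, cylPt r θ z)` the small cylinder `Q(ζ⁺, R')`,
`R' = min(λ/2, 1/8)`, lies in one box (hence carries the bound `B_*` for `k ≥ k_*`), inside the slab and inside `Q(0,2)` where the normalised
pressures have `∫|π̃|^{3/2} ≤ P(I₀)` (`lintegral_pressure_le_of_unitBallMean_eq_zero`); S2 gives `‖v_{σk}‖, ‖fderiv‖ ≤ B'(R', B_*, P)` at `ζ`.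
CONTRADICTION at `n = σ k` with `k ≥ k_*`, `n > B'`, `1/(n+1) ≤ δ`.

* **`shellFact_of_atoms`** — the piece S5.

WHAT THIS IS NOT: no NS-regularity statement is touched; N3 is an INPUT (the class-specialised consequence of Lei–Ren 2024 Thm 2/Prop 9, proved
by compactness); item 26889 closes only when `shellFact_holds` lands AND the LEAD re-plugs `averagedConeLiouville_of_leiRen`; the summit stays
OPEN.  `--supports stmt-NavierStokesRegularity-26889 --as helper`.
[cite: CaffarelliKohnNirenberg1982, Theorem B] [cite: Lin1998, Thm 2.2] [cite: AlbrittonBarker2019, Lemma 2.2, Prop. 2.3, §3]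
[cite: Tsai1998, remark after Lemma 4.2] [cite: LeiRen2024QuantitativePartialRegularity, Thm 2 / Prop 9]
-/

noncomputable section

-- the summit and its single sub-problem share the name (CONVENTIONS §1)
set_option linter.dupNamespace false

open MeasureTheory Set Function Metric Filter Topology
open scoped NNReal ENNReal InnerProductSpace

namespace Summit.NavierStokesRegularity.NavierStokesRegularity.Theorems.AveragedConeLiouville.Shell

open Literature.Analysis Literature.Analysis.FluidPDE
open Summit.NavierStokesRegularity.NavierStokesRegularity.Theorems.AxisTwistDoorAveragedConeLiouvilleDefs
open Summit.NavierStokesRegularity.NavierStokesRegularity.Theorems.AveragedConeLiouville.ShellBookkeeping (cylPt_apply cylRadius_cylPt)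

/-! ### Geometry of the shell box -/

/-- A closed radial/vertical box over a closed time interval is compact. [folklore] -/
theorem isCompact_box (t₁ t₂ r₁ r₂ h : ℝ) :
    IsCompact (Icc t₁ t₂ ×ˢ {x : EuclideanSpace ℝ (Fin 3) | cylRadius x ∈ Icc r₁ r₂ ∧ |x 2| ≤ h}) := by
  refine isCompact_Icc.prod (Metric.isCompact_of_isClosed_isBounded ?_ ?_)
  · have h1 : IsClosed {x : EuclideanSpace ℝ (Fin 3) | cylRadius x ∈ Icc r₁ r₂} :=
      isClosed_Icc.preimage continuous_cylRadius
    have h2 : IsClosed {x : EuclideanSpace ℝ (Fin 3) | |x 2| ≤ h} :=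
      isClosed_le (continuous_abs.comp (EuclideanSpace.proj (2 : Fin 3)).continuous) continuous_const
    exact h1.inter h2
  · refine (Metric.isBounded_closedBall (x := (0 : EuclideanSpace ℝ (Fin 3))) (r := |r₂| + |h|)).subset ?_
    rintro x ⟨hr, hz⟩
    rw [mem_closedBall, dist_zero_right, EuclideanSpace.norm_eq, Fin.sum_univ_three]
    simp only [Real.norm_eq_abs, sq_abs]
    have hcr : Real.sqrt (x 0 ^ 2 + x 1 ^ 2) ≤ r₂ := hr.2
    have hcr0 : 0 ≤ Real.sqrt (x 0 ^ 2 + x 1 ^ 2) := Real.sqrt_nonneg _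
    have hsq : x 0 ^ 2 + x 1 ^ 2 = Real.sqrt (x 0 ^ 2 + x 1 ^ 2) ^ 2 := (Real.sq_sqrt (by positivity)).symm
    have h3 : x 0 ^ 2 + x 1 ^ 2 + x 2 ^ 2 ≤ (|r₂| + |h|) ^ 2 := by
      rw [hsq, ← sq_abs (x 2)]
      have h4 : Real.sqrt (x 0 ^ 2 + x 1 ^ 2) ≤ |r₂| := hcr.trans (le_abs_self _)
      have h5 : |x 2| ≤ |h| := hz.trans (le_abs_self _)
      have h6 := mul_le_mul h4 h4 hcr0 (abs_nonneg _)
      have h7 := mul_le_mul h5 h5 (abs_nonneg _) (abs_nonneg _)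
      nlinarith [abs_nonneg r₂, abs_nonneg h, h6, h7]
    calc Real.sqrt (x 0 ^ 2 + x 1 ^ 2 + x 2 ^ 2) ≤ Real.sqrt ((|r₂| + |h|) ^ 2) := Real.sqrt_le_sqrt h3
      _ = |r₂| + |h| := Real.sqrt_sq (by positivity)

/-! ### The piece S5 -/

set_option maxHeartbeats 1600000 in
/-- **N3 piece S5: `ShellFact` from the four atom texts** (`Sig.lidNull`, `Sig.gradBound`, `Sig.radialGap`, `Sig.stability` of the N3 skeleton,
`δ`-unfolded); proof in the module docstring. [cite: LeiRen2024QuantitativePartialRegularity, Thm 2 / Prop 9 (qualitative, by compactness)] -/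
theorem shellFact_of_atoms :
    (∀ (u : ℝ → EuclideanSpace ℝ (Fin 3) → EuclideanSpace ℝ (Fin 3)) (p : ℝ → EuclideanSpace ℝ (Fin 3) → ℝ)
      (H : ℝ → EuclideanSpace ℝ (Fin 3) → EuclideanSpace ℝ (Fin 3) →L[ℝ] EuclideanSpace ℝ (Fin 3)),
      IsSuitableWeakSolutionOn (slab (EuclideanSpace ℝ (Fin 3)) (Iio (0 : ℝ)) isOpen_Iio) 1 0 u p →
      HasWeakSpatialGradientOn (slab (EuclideanSpace ℝ (Fin 3)) (Iio (0 : ℝ)) isOpen_Iio) u H →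
      typeIBound (Iio (0 : ℝ) ×ˢ (univ : Set (EuclideanSpace ℝ (Fin 3)))) u p H < ⊤ →
      IsParabolicNull 1 {z : ℝ × EuclideanSpace ℝ (Fin 3) | z.1 = 0 ∧ IsBackwardSingularPoint u z}) →
    (∀ (R M : ℝ) (P : ℝ≥0), 0 < R → ∃ B : ℝ, 0 ≤ B ∧
      ∀ (v : ℝ → EuclideanSpace ℝ (Fin 3) → EuclideanSpace ℝ (Fin 3)) (π : ℝ → EuclideanSpace ℝ (Fin 3) → ℝ)
        (z : ℝ × EuclideanSpace ℝ (Fin 3)),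
        IsSuitableWeakSolutionOn (parabolicCylinderOpens R z) 1 0 v π →
        ContinuousOn (uncurry v) (parabolicCylinder R z) →
        (∀ᵐ w ∂(volume.restrict (parabolicCylinder R z)), ‖v w.1 w.2‖ ≤ M) →
        ∫⁻ w in parabolicCylinder R z, ‖π w.1 w.2‖ₑ ^ (3 / 2 : ℝ) ≤ (P : ℝ≥0∞) →
        ∀ w ∈ parabolicCylinder (R / 2) z, ‖v w.1 w.2‖ ≤ B ∧ ‖fderiv ℝ (v w.1) w.2‖ ≤ B) →
    (∀ (S : Set (ℝ × EuclideanSpace ℝ (Fin 3))) (α β : ℝ), IsCompact S → IsParabolicNull 1 S → α < β →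
      ∃ a δ : ℝ, 0 < δ ∧ α < a - 2 * δ ∧ a + 2 * δ < β ∧
        ∀ z ∈ S, cylRadius z.2 < a - 2 * δ ∨ a + 2 * δ < cylRadius z.2) →
    (∀ (I₀ : ℝ≥0∞), I₀ < ⊤ →
    ∀ (v : ℕ → ℝ → EuclideanSpace ℝ (Fin 3) → EuclideanSpace ℝ (Fin 3)) (q : ℕ → ℝ → EuclideanSpace ℝ (Fin 3) → ℝ)
      (G : ℕ → ℝ → EuclideanSpace ℝ (Fin 3) → EuclideanSpace ℝ (Fin 3) →L[ℝ] EuclideanSpace ℝ (Fin 3))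
      (u : ℝ → EuclideanSpace ℝ (Fin 3) → EuclideanSpace ℝ (Fin 3)),
      (∀ k, IsSuitableWeakSolutionOn (slab (EuclideanSpace ℝ (Fin 3)) (Iio (0 : ℝ)) isOpen_Iio) 1 0 (v k) (q k)) →
      (∀ k, HasWeakSpatialGradientOn (slab (EuclideanSpace ℝ (Fin 3)) (Iio (0 : ℝ)) isOpen_Iio) (v k) (G k)) →
      (∀ k, typeIBound (Iio (0 : ℝ) ×ˢ (univ : Set (EuclideanSpace ℝ (Fin 3)))) (v k) (q k) (G k) ≤ I₀) →
      (∀ R₀ : ℝ, 0 < R₀ → Tendsto (fun k => eLpNorm (uncurry (v k) - uncurry u) 3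
          (volume.restrict (parabolicCylinder R₀ (0 : ℝ × EuclideanSpace ℝ (Fin 3))))) atTop (𝓝 0)) →
      ∀ (zbar : ℝ × EuclideanSpace ℝ (Fin 3)) (R M : ℝ), zbar.1 ≤ 0 → 0 < R →
        (∀ᵐ w ∂(volume.restrict (parabolicCylinder R zbar)), ‖u w.1 w.2‖ ≤ M) →
        ∃ (B : ℝ) (k₀ : ℕ), ∀ k, k₀ ≤ k →
          ∀ᵐ w ∂(volume.restrict (parabolicCylinder (R / 2) zbar)), ‖v k w.1 w.2‖ ≤ B) →
    ShellFact := by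
  intro hS1 hS2 hS3 hS4 I₀ hI₀
  by_contra hneg
  push Not at hneg
  -- ### the violating sequence
  have hex : ∀ n : ℕ, ∃ (C : ℝ) (v : ℝ → EuclideanSpace ℝ (Fin 3) → EuclideanSpace ℝ (Fin 3))
      (π : ℝ → EuclideanSpace ℝ (Fin 3) → ℝ) (H : ℝ → EuclideanSpace ℝ (Fin 3) → EuclideanSpace ℝ (Fin 3) →L[ℝ] EuclideanSpace ℝ (Fin 3)),
      InClass C v π H ∧ typeIBound (Set.Iio (0 : ℝ) ×ˢ Set.univ) v π H ≤ I₀ ∧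
        ∀ a δ : ℝ, 2 / 3 < a → a < 4 / 5 → 1 / ((n : ℝ) + 1) ≤ δ → δ ≤ 1 / 10 →
          ∃ t : ℝ, -(a + δ) ^ 2 < t ∧ t < 0 ∧ ∃ r θ z : ℝ, a - δ < r ∧ r < a + δ ∧ |z| < a + δ ∧
            (‖v t (cylPt r θ z)‖ ≤ n → (n : ℝ) < ‖fderiv ℝ (v t) (cylPt r θ z)‖) :=
    fun n => hneg (1 / ((n : ℝ) + 1)) n (by positivity) n.cast_nonneg
  choose C v π H hcls hI hbad using hex
  -- ### normalised pressures ([U] by name) and compactness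
  set πn : ℕ → ℝ → EuclideanSpace ℝ (Fin 3) → ℝ :=
    fun n t x => π n t x - ⨍ y in ball (0 : EuclideanSpace ℝ (Fin 3)) 1, π n t y with hπn
  have hswn : ∀ n, IsSuitableWeakSolutionOn (slab (EuclideanSpace ℝ (Fin 3)) (Iio (0 : ℝ)) isOpen_Iio) 1 0 (v n) (πn n) :=
    fun n => (hcls n).suitable.sub_unitBallMean_slab
  have hwg : ∀ n, HasWeakSpatialGradientOn (slab (EuclideanSpace ℝ (Fin 3)) (Iio (0 : ℝ)) isOpen_Iio) (v n) (H n) :=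
    fun n => (hcls n).weakGrad
  have hbd : ∀ n, typeIBound (Iio (0 : ℝ) ×ˢ (univ : Set (EuclideanSpace ℝ (Fin 3)))) (v n) (πn n) (H n) ≤ I₀ := by
    intro n
    have h := typeIBound_sub_unitBallMean (u := v n) (G := H n) (hcls n).suitable.distributional.2.2.1
    show typeIBound (Iio (0 : ℝ) ×ˢ (univ : Set (EuclideanSpace ℝ (Fin 3)))) (v n)
      (fun t x => π n t x - ⨍ y in ball (0 : EuclideanSpace ℝ (Fin 3)) 1, π n t y) (H n) ≤ I₀
    rw [h]
    exact hI n
  have h0 : ∀ n t, ⨍ y in ball (0 : EuclideanSpace ℝ (Fin 3)) 1, πn n t y = 0 := fun n t =>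
    unitBallMean_sub_unitBallMean (π n) t
  obtain ⟨u, p, Hu, σ, hσ, hswu, hwgu, hIu, hconv, -⟩ := slab_typeI_compactness_sharp I₀ v πn H hI₀ hswn hwg hbd
  -- ### the compact slab-singular set `Σ♭ = K₀ ∖ G(u)` and its nullity
  set G : Set (ℝ × EuclideanSpace ℝ (Fin 3)) := {w : ℝ × EuclideanSpace ℝ (Fin 3) | ∃ ρ : ℝ, 0 < ρ ∧ ∃ M : ℝ,
      ∀ᵐ q ∂(volume.restrict (parabolicCylinderCentered ρ w ∩ (Iio (0 : ℝ) ×ˢ (univ : Set (EuclideanSpace ℝ (Fin 3)))))),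
        ‖u q.1 q.2‖ ≤ M} with hG
  set K₀ : Set (ℝ × EuclideanSpace ℝ (Fin 3)) :=
    Icc (-1 : ℝ) 0 ×ˢ {x : EuclideanSpace ℝ (Fin 3) | cylRadius x ∈ Icc (1 / 2 : ℝ) 1 ∧ |x 2| ≤ 1} with hK₀
  have hK₀c : IsCompact K₀ := isCompact_box (-1) 0 (1 / 2) 1 1
  have hK₀t : ∀ w ∈ K₀, w.1 ≤ 0 := fun w hw => hw.1.2
  have hSgc : IsCompact (K₀ \ G) := hK₀c.diff (isOpen_slabRegular u)
  have hCKN : IsParabolicNull 1 (singularSet u (Iio (0 : ℝ) ×ˢ (univ : Set (EuclideanSpace ℝ (Fin 3))))) := by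
    have h := ckn_partial_regularity_holds (slab (EuclideanSpace ℝ (Fin 3)) (Iio (0 : ℝ)) isOpen_Iio) one_pos hswu
      (isCKNForceOn_zero _)
    simpa only [coe_slab] using h
  have hLid : IsParabolicNull 1 {z : ℝ × EuclideanSpace ℝ (Fin 3) | z.1 = 0 ∧ IsBackwardSingularPoint u z} :=
    hS1 u p Hu hswu hwgu (lt_of_le_of_lt hIu hI₀)
  have hSgnull : IsParabolicNull 1 (K₀ \ G) :=
    (isParabolicNull_union hCKN hLid).mono (diff_slabRegular_subset hK₀t)
  -- ### the radial gap (S3)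
  obtain ⟨a, δ', hδ'0, ha1, ha2, hgap⟩ := hS3 (K₀ \ G) (2 / 3) (4 / 5) hSgc hSgnull (by norm_num)
  obtain ⟨δ, hδ⟩ : ∃ x : ℝ, x = min δ' (1 / 10) := ⟨_, rfl⟩
  have hδ0 : 0 < δ := by rw [hδ]; exact lt_min hδ'0 (by norm_num)
  have hδδ' : δ ≤ δ' := by rw [hδ]; exact min_le_left _ _
  have hδ10 : δ ≤ 1 / 10 := by rw [hδ]; exact min_le_right _ _
  have ha23 : 2 / 3 < a := by linarith
  have ha45 : a < 4 / 5 := by linarith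
  have haδ0 : 0 < a - δ := by linarith
  have haδ1 : a + δ ≤ 9 / 10 := by linarith
  -- ### the closed shell `S̄ ⊆ G(u)` (compact)
  set Sb : Set (ℝ × EuclideanSpace ℝ (Fin 3)) :=
    Icc (-(a + δ) ^ 2) 0 ×ˢ {x : EuclideanSpace ℝ (Fin 3) | cylRadius x ∈ Icc (a - δ) (a + δ) ∧ |x 2| ≤ a + δ} with hSb
  have hSbc : IsCompact Sb := isCompact_box _ _ _ _ _
  have hSbK : Sb ⊆ K₀ := by
    rintro w ⟨⟨hw1, hw2⟩, ⟨hw3, hw4⟩, hw5⟩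
    have hsq : (a + δ) ^ 2 ≤ 1 := by nlinarith
    exact ⟨⟨by linarith, hw2⟩, ⟨by linarith, by linarith⟩, by linarith⟩
  have hSbG : ∀ w ∈ Sb, w ∈ G := by
    intro w hw
    by_contra hwG
    have hwSg : w ∈ K₀ \ G := ⟨hSbK hw, hwG⟩
    obtain ⟨-, ⟨hw3, hw4⟩, -⟩ := hw
    rcases hgap w hwSg with h | h <;> linarith
  -- radius and bound at each point of the shell, then S4 at the raised vertex
  have hρM : ∀ w ∈ Sb, ∃ ρ : ℝ, 0 < ρ ∧ ∃ M : ℝ,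
      ∀ᵐ q ∂(volume.restrict (parabolicCylinderCentered ρ w ∩ (Iio (0 : ℝ) ×ˢ (univ : Set (EuclideanSpace ℝ (Fin 3)))))),
        ‖u q.1 q.2‖ ≤ M := fun w hw => hSbG w hw
  choose! ρ hρ M hM using hρM
  have hSbt : ∀ w ∈ Sb, w.1 ≤ 0 := fun w hw => hw.1.2
  have hstab : ∀ w ∈ Sb, ∃ (B : ℝ) (k₀ : ℕ), ∀ k, k₀ ≤ k →
      ∀ᵐ q ∂(volume.restrict (parabolicCylinder (ρ w / 2 / 2)
        ((min (w.1 + ρ w ^ 2 / 32) 0, w.2) : ℝ × EuclideanSpace ℝ (Fin 3)))), ‖v (σ k) q.1 q.2‖ ≤ B := by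
    intro w hw
    refine hS4 I₀ hI₀ (fun k => v (σ k)) (fun k => πn (σ k)) (fun k => H (σ k)) u (fun k => hswn (σ k))
      (fun k => hwg (σ k)) (fun k => hbd (σ k)) hconv ((min (w.1 + ρ w ^ 2 / 32) 0, w.2)) (ρ w / 2) (M w)
      (min_le_right _ _) (by linarith [hρ w hw]) ?_
    exact ae_restrict_of_ae_restrict_of_subset (cylinder_raised_subset (hSbt w hw) (hρ w hw)) (hM w hw)
  choose! Bw kw hstabw using hstab
  -- ### a finite subcover by the open boxes, its uniform bound, its Lebesgue number
  set O : ℝ × EuclideanSpace ℝ (Fin 3) → Set (ℝ × EuclideanSpace ℝ (Fin 3)) :=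
    fun w => Ioo (min (w.1 + ρ w ^ 2 / 32) 0 - ρ w ^ 2 / 16) (w.1 + ρ w ^ 2 / 32) ×ˢ ball w.2 (ρ w / 4) with hO
  have hOo : ∀ w, IsOpen (O w) := fun w => isOpen_Ioo.prod isOpen_ball
  obtain ⟨T, hTS, hTcov⟩ := hSbc.elim_nhds_subcover O (fun w hw => (hOo w).mem_nhds (mem_box (hρ w hw)))
  obtain ⟨Bst, hBst⟩ : ∃ x : ℝ, x = ∑ w ∈ T, |Bw w| := ⟨_, rfl⟩
  obtain ⟨kst, hkst⟩ : ∃ x : ℕ, x = ∑ w ∈ T, kw w := ⟨_, rfl⟩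
  have hBst0 : 0 ≤ Bst := by rw [hBst]; exact Finset.sum_nonneg fun w _ => abs_nonneg _
  have hunif : ∀ k, kst ≤ k → ∀ w ∈ T,
      ∀ᵐ q ∂(volume.restrict (O w ∩ (Iio (0 : ℝ) ×ˢ (univ : Set (EuclideanSpace ℝ (Fin 3)))))), ‖v (σ k) q.1 q.2‖ ≤ Bst := by
    intro k hk w hwT
    have hwS : w ∈ Sb := hTS w hwT
    have hkw : kw w ≤ k := le_trans (by rw [hkst]; exact Finset.single_le_sum (fun _ _ => Nat.zero_le _) hwT) hk
    have hBw : Bw w ≤ Bst := by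
      rw [hBst]
      exact (le_abs_self _).trans (Finset.single_le_sum (f := fun w => |Bw w|) (fun _ _ => abs_nonneg _) hwT)
    have h := ae_restrict_of_ae_restrict_of_subset (box_inter_slab_subset w (ρ w)) (hstabw w hwS k hkw)
    filter_upwards [h] with q hq using hq.trans hBw
  obtain ⟨lam, hlam0, hleb⟩ := lebesgue_number_lemma_of_metric (ι := T) (c := fun w => O w) hSbc (fun w => hOo w)
    (by intro w hw; obtain ⟨i, hi⟩ := mem_iUnion₂.1 (hTcov hw); exact mem_iUnion.2 ⟨⟨i, hi.1⟩, hi.2⟩)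
  obtain ⟨lam', hlam'⟩ : ∃ x : ℝ, x = min lam 1 := ⟨_, rfl⟩
  have hlam'0 : 0 < lam' := by rw [hlam']; exact lt_min hlam0 one_pos
  have hlam'1 : lam' ≤ 1 := by rw [hlam']; exact min_le_right _ _
  have hlam'l : lam' ≤ lam := by rw [hlam']; exact min_le_left _ _
  obtain ⟨R', hR'⟩ : ∃ x : ℝ, x = min (lam' / 2) (1 / 8) := ⟨_, rfl⟩
  have hR'0 : 0 < R' := by rw [hR']; exact lt_min (by positivity) (by norm_num)
  have hR'l : R' ≤ lam' / 2 := by rw [hR']; exact min_le_left _ _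
  have hR'8 : R' ≤ 1 / 8 := by rw [hR']; exact min_le_right _ _
  -- ### the uniform pressure bound on `Q(0,2)` and the S2 constant
  have hcP : (2 * (1 + volume (ball (0 : EuclideanSpace ℝ (Fin 3)) 2) * (volume (ball (0 : EuclideanSpace ℝ (Fin 3)) 1))⁻¹) *
      (ENNReal.ofReal 2 ^ 2 * I₀)) ≠ ⊤ := by
    rw [← mul_assoc]
    exact ENNReal.mul_ne_top (pressureConst_lt_top 2).ne hI₀.ne
  set P : ℝ≥0 := (2 * (1 + volume (ball (0 : EuclideanSpace ℝ (Fin 3)) 2) * (volume (ball (0 : EuclideanSpace ℝ (Fin 3)) 1))⁻¹) *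
      (ENNReal.ofReal 2 ^ 2 * I₀)).toNNReal with hP
  have hPeq : (P : ℝ≥0∞) = 2 * (1 + volume (ball (0 : EuclideanSpace ℝ (Fin 3)) 2) *
      (volume (ball (0 : EuclideanSpace ℝ (Fin 3)) 1))⁻¹) * (ENNReal.ofReal 2 ^ 2 * I₀) := by
    rw [hP, ENNReal.coe_toNNReal hcP]
  have hpress : ∀ k, ∫⁻ q in parabolicCylinder 2 (0 : ℝ × EuclideanSpace ℝ (Fin 3)), ‖πn (σ k) q.1 q.2‖ₑ ^ (3 / 2 : ℝ) ≤ (P : ℝ≥0∞) := by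
    intro k
    rw [hPeq]
    refine (lintegral_pressure_le_of_unitBallMean_eq_zero (hswn (σ k)).distributional.2.2.1 (h0 (σ k)) (by norm_num : (1:ℝ) ≤ 2)).trans ?_
    gcongr
    exact (cknDOsc_le_abScaledSum (u := v (σ k)) (G := H (σ k))).trans
      ((abScaledSum_le_typeIBound two_pos (parabolicCylinder_subset_lowerHalf le_rfl 2)).trans (hbd (σ k)))
  obtain ⟨B', hB'0, hS2'⟩ := hS2 R' Bst P hR'0
  -- ### the index `n = σ k`
  obtain ⟨k, hk⟩ : ∃ k : ℕ, kst ≤ k ∧ ⌈B'⌉₊ + 1 ≤ k ∧ ⌈1 / δ⌉₊ ≤ k :=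
    ⟨max kst (max (⌈B'⌉₊ + 1) ⌈1 / δ⌉₊), le_max_left _ _, (le_max_left _ _).trans (le_max_right _ _),
      (le_max_right _ _).trans (le_max_right _ _)⟩
  have hσk : k ≤ σ k := hσ.id_le k
  have hnB' : B' < (σ k : ℝ) := by
    have h1 : B' ≤ ⌈B'⌉₊ := Nat.le_ceil _
    have h2 : ((⌈B'⌉₊ + 1 : ℕ) : ℝ) ≤ k := by exact_mod_cast hk.2.1
    have h3 : (k : ℝ) ≤ σ k := by exact_mod_cast hσk
    push_cast at h2
    linarith
  have hnδ : 1 / ((σ k : ℝ) + 1) ≤ δ := by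
    have h1 : 1 / δ ≤ ⌈1 / δ⌉₊ := Nat.le_ceil _
    have h2 : (⌈1 / δ⌉₊ : ℝ) ≤ k := by exact_mod_cast hk.2.2
    have h3 : (k : ℝ) ≤ σ k := by exact_mod_cast hσk
    rw [div_le_iff₀ (by positivity)]
    have h4 : 1 / δ ≤ (σ k : ℝ) + 1 := by linarith
    rw [div_le_iff₀ hδ0] at h4
    linarith
  -- ### the violating point of the `σ k`-th profile and the contradiction
  obtain ⟨t, ht1, ht2, r, θ, z, hr1, hr2, hz, hviol⟩ := hbad (σ k) a δ ha23 ha45 hnδ hδ10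
  have hζpt : (min (t + R' ^ 2 / 8) 0 : ℝ) ≤ 0 := min_le_right _ _
  have hr0 : 0 ≤ r := by linarith
  have hζS : ((t, cylPt r θ z) : ℝ × EuclideanSpace ℝ (Fin 3)) ∈ Sb := by
    refine ⟨⟨ht1.le, ht2.le⟩, ⟨?_, ?_⟩, ?_⟩
    · show a - δ ≤ cylRadius (cylPt r θ z)
      rw [cylRadius_cylPt hr0]; exact hr1.le
    · show cylRadius (cylPt r θ z) ≤ a + δ
      rw [cylRadius_cylPt hr0]; exact hr2.le
    · show |(cylPt r θ z) 2| ≤ a + δ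
      rw [(cylPt_apply r θ z).2.2]; exact hz.le
  -- the small cylinder around `ζ` lies in one box, inside the slab and inside `Q(0,2)`
  obtain ⟨i, hi⟩ := hleb ((t, cylPt r θ z) : ℝ × EuclideanSpace ℝ (Fin 3)) hζS
  have hQO : parabolicCylinder R' ((min (t + R' ^ 2 / 8) 0, cylPt r θ z) : ℝ × EuclideanSpace ℝ (Fin 3)) ⊆ O i :=
    ((smallCylinder_subset_ball (ζ := ((t, cylPt r θ z) : ℝ × EuclideanSpace ℝ (Fin 3))) hR'0 hR'l hlam'1 ht2.le).trans (ball_subset_ball hlam'l)).trans hi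
  have hQslab : parabolicCylinder R' ((min (t + R' ^ 2 / 8) 0, cylPt r θ z) : ℝ × EuclideanSpace ℝ (Fin 3)) ⊆ Iio (0 : ℝ) ×ˢ (univ : Set (EuclideanSpace ℝ (Fin 3))) :=
    parabolicCylinder_subset_lowerHalf (z := ((min (t + R' ^ 2 / 8) 0, cylPt r θ z) : ℝ × EuclideanSpace ℝ (Fin 3))) hζpt R'
  have hxn : ‖cylPt r θ z‖ ≤ 9 / 5 := by
    refine (CircleLimits.norm_cylPt_le r θ z).trans ?_
    rw [abs_of_nonneg hr0]
    linarith [le_of_lt hz]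
  have hQ2 : parabolicCylinder R' ((min (t + R' ^ 2 / 8) 0, cylPt r θ z) : ℝ × EuclideanSpace ℝ (Fin 3)) ⊆ parabolicCylinder 2 (0 : ℝ × EuclideanSpace ℝ (Fin 3)) := by
    rintro q ⟨⟨hq1, hq2⟩, hq3⟩
    simp only at hq1 hq2 hq3
    have hsq : (a + δ) ^ 2 ≤ 1 := by nlinarith
    have hmin : t - R' ^ 2 ≤ min (t + R' ^ 2 / 8) 0 := le_min (by nlinarith) (by nlinarith)
    refine ⟨⟨?_, ?_⟩, ?_⟩
    · show (0 : ℝ × EuclideanSpace ℝ (Fin 3)).1 - 2 ^ 2 < q.1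
      simp only [Prod.fst_zero]
      nlinarith
    · show q.1 < (0 : ℝ × EuclideanSpace ℝ (Fin 3)).1
      simp only [Prod.fst_zero]
      exact lt_of_lt_of_le hq2 hζpt
    · show q.2 ∈ ball (0 : ℝ × EuclideanSpace ℝ (Fin 3)).2 2
      rw [Prod.snd_zero, mem_ball_zero_iff]
      have hd : dist q.2 (cylPt r θ z) < R' := hq3
      rw [dist_eq_norm] at hd
      calc ‖q.2‖ ≤ ‖q.2 - cylPt r θ z‖ + ‖cylPt r θ z‖ := norm_le_norm_sub_add _ _
        _ < 2 := by linarith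
  -- S2 at the raised vertex `ζ⁺` for the `σ k`-th profile
  have hsuit : IsSuitableWeakSolutionOn (parabolicCylinderOpens R' ((min (t + R' ^ 2 / 8) 0, cylPt r θ z) : ℝ × EuclideanSpace ℝ (Fin 3))) 1 0 (v (σ k)) (πn (σ k)) :=
    (hswn (σ k)).of_le (parabolicCylinderOpens_le_slab R' (z := ((min (t + R' ^ 2 / 8) 0, cylPt r θ z) : ℝ × EuclideanSpace ℝ (Fin 3))) hζpt)
  have hcont : ContinuousOn (uncurry (v (σ k))) (parabolicCylinder R' ((min (t + R' ^ 2 / 8) 0, cylPt r θ z) : ℝ × EuclideanSpace ℝ (Fin 3))) := (hcls (σ k)).cont.mono hQslab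
  have hbound : ∀ᵐ q ∂(volume.restrict (parabolicCylinder R' ((min (t + R' ^ 2 / 8) 0, cylPt r θ z) : ℝ × EuclideanSpace ℝ (Fin 3)))), ‖v (σ k) q.1 q.2‖ ≤ Bst :=
    ae_restrict_of_ae_restrict_of_subset (subset_inter hQO hQslab) (hunif k hk.1 i i.2)
  have hpk : ∫⁻ q in parabolicCylinder R' ((min (t + R' ^ 2 / 8) 0, cylPt r θ z) : ℝ × EuclideanSpace ℝ (Fin 3)), ‖πn (σ k) q.1 q.2‖ₑ ^ (3 / 2 : ℝ) ≤ (P : ℝ≥0∞) :=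
    (lintegral_mono_set hQ2).trans (hpress k)
  obtain ⟨hvB, hdB⟩ := hS2' (v (σ k)) (πn (σ k)) ((min (t + R' ^ 2 / 8) 0, cylPt r θ z) : ℝ × EuclideanSpace ℝ (Fin 3)) hsuit hcont hbound hpk ((t, cylPt r θ z) : ℝ × EuclideanSpace ℝ (Fin 3))
    (mem_smallCylinder_half (ζ := ((t, cylPt r θ z) : ℝ × EuclideanSpace ℝ (Fin 3))) hR'0 ht2)
  have hvB' : ‖v (σ k) t (cylPt r θ z)‖ ≤ B' := hvB
  have hdB' : ‖fderiv ℝ (v (σ k) t) (cylPt r θ z)‖ ≤ B' := hdB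
  have hcontra := hviol (hvB'.trans hnB'.le)
  linarith

end Summit.NavierStokesRegularity.NavierStokesRegularity.Theorems.AveragedConeLiouville.Shell

end
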